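import Summits.HodgeConjecture.HodgeConjecture.Theorems.NodalThetaWeilNodeDualClassesAlgebraicNodalBoundaryCertificate
import Literature.AlgebraicGeometry.HodgeTheory.AlgebraicClassesGysinOneSpan
import HarnessLib

/-!
# Crux `NodeDualClassesAlgebraic` (stmt-HodgeConjecture-7745), nodal-boundary line — part 3:
# THE TARGET `WeilSixfolds` IS EQUIVALENT TO "ONE THREEFOLD WITH A NON-ZERO WEIL COMPONENT"

Route `HodgeConjecture/NodalThetaWeil`; continuation of parts 1–2
(`NodalThetaWeilNodeDualClassesAlgebraicNodalBoundary{,Certificate}`: K-rigidity of algebraicity on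
the Weil plane; the canonical certificate `s ∉ W'`, `W'` the span of the mixed `K`-eigenclass spaces
`⋀ᵃ V₊ ⊗ ⋀ᵇ V₋`, `a + b = 6`, `a, b ≥ 1`). Here the residual is brought to its FINAL explicit form and
shown to be EQUIVALENT to the route target: `N³H⁶(A(ℂ); ℂ)` is the span of the fundamental classes
`g_* 1_V` of smooth projective threefolds `g : V ⟶ A` (the tree's `algebraicClasses_eq_span_complexGysin_one`,
Fulton §19.1 / Deligne Remark (vi), unconditional via Deligne Hodge III 8.2.8 + Hironaka), so "some
algebraic class lies off `W'`" is "some threefold class `g_* 1_V` lies off `W'`".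

## What is proved (no `sorry`, no definition, no named fact)

* `exists_algebraic_not_mem_nonWeil_iff_exists_threefold` — on an abelian sixfold: (∃ algebraic
  `s ∈ N³H⁶`, `s ∉ W'`) `↔` (∃ smooth projective threefold `g : V ⟶ A` with `g_* 1_V ∉ W'`).
* `weilSixfolds_pointwise_iff_exists_threefold` — on a BALANCED Weil sixfold: the Hodge conjecture for
  the Weil plane `↔` some threefold `g : V ⟶ A` has `g_* 1_V ∉ W'` (its class has a non-zero Weil
  component — the period-free `K`-certificate of part 2).
* **`weilSixfolds_iff_threefoldWeilCarriers`** — the route TARGET `WeilSixfolds` (stmt-2524) is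
  EQUIVALENT to the carrier statement «every balanced Weil sixfold `(A, φ ≫ φ = -d·𝟙)` carries a smooth
  projective threefold `g : V ⟶ A` whose class `g_* 1_V ∈ H⁶(A(ℂ); ℂ)` is not in the mixed span `W'`»;
  `nodeDualClassesAlgebraic_of_threefoldWeilCarriers`, `nodalThetaSupport_of_threefoldWeilCarriers` — the
  same statement closes BOTH cruxes of the route (X2 = stmt-7745 and X1 = stmt-7744, the latter through
  `N³ ≤ N¹`).
* `threefoldWeilCarriers_of_nodalThetaCarriers` — the nodal-boundary carrier statement of part 2 (the
  threefold INSIDE a nodal member of `|kΘ|`, through a node) implies the threefold form by forgetting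
  the theta clauses. (The converse — every threefold of `A⁶` lies in a nodal high multiple of `Θ` with
  its nodes on the threefold and maximal-isotropic tangent spaces — is the Kleiman–Altman Bertini
  theorem, not typed here; so the nodal decoration is free GIVEN the cycle, and the content of the line
  is exactly the threefold and its certificate.)

HONEST STATUS. An equivalence split of the target with all difficulty located: nothing here is a case
of the Hodge conjecture. For the general member of a `9`-dimensional Weil family off discriminant `-1`
no such threefold is known (Markman's secant-sheaf classes give one on discriminant `-1`).
References: [Thomas2005Nodes] Thm. 1, §3 eq. (d), §4; [vanGeemen1994HodgeAV] 4.9–4.11, proof of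
Thm. 6.12; [Deligne1982HodgeCycles] Prop. 4.4; [Fulton1998] §19.1; [DeligneHodgeIII1974] Cor. 8.2.8.
-/

noncomputable section

set_option linter.dupNamespace false

open CategoryTheory AlgebraicGeometry
open Literature.AlgebraicGeometry.Motives Literature.AlgebraicGeometry.HodgeTheory
  Literature.AlgebraicGeometry.Resolution
  Literature.AlgebraicTopology.SingularHomology
open Summit.HodgeConjecture.HodgeConjecture.Theses.NodalThetaWeil

namespace Summit.HodgeConjecture.HodgeConjecture.Theorems.NodeDualClassesAlgebraic

/-- `nonWeil A φ d` — the span `W'` of the mixed `K`-eigenclass spaces of `H⁶(A(ℂ); ℂ)` (display only;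
same text as in part 2). -/
local notation3 "nonWeil " A:max φ:max d:max =>
  (⨆ (a : ℕ) (b : ℕ) (_ : a + b = 2 * 3) (_ : 0 < a) (_ : 0 < b),
    pullbackEigenclasses A φ (2 * 3) (fun x y =>
      ((x : ℂ) + (y : ℂ) * Complex.I * (Real.sqrt d : ℂ)) ^ a *
        ((x : ℂ) - (y : ℂ) * Complex.I * (Real.sqrt d : ℂ)) ^ b))

/-- `IsNodalThetaMember A Θ k ι` (display only; same text as in parts 1–2 and the 7744 files). -/
local notation3 "IsNodalThetaMember " A:max Θ:max k:max ι:max =>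
  (∃ m : ℕ, 1 ≤ m ∧ IsNodalDivisor 5 m ι ∧
    ∃ hI : IsEffectiveCartier (ι).left.ker,
      (CartierDivisor.ofIsEffectiveCartier (ι).left.ker hI).LinEquiv (k • Θ))

/-- `ThreefoldWeilCarriers` — the residual of the line in its final explicit form (display only):
every BALANCED Weil sixfold carries a smooth projective threefold whose fundamental class in `H⁶` has a
non-zero Weil component. -/
local notation3 (prettyPrint := false) "ThreefoldWeilCarriers" =>
  (∀ (d : ℕ), 0 < d → ∀ (A : AbelianVariety ℂ) (φ : A ⟶ A), A.dim = 2 * 3 →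
    ∀ hsp : IsSmoothProjective (2 * 3) A.X, φ ≫ φ = -(d • 𝟙 A) →
    Module.finrank ℂ ↥(Module.End.eigenspace (complexBetti.map φ.hom.hom.hom 1).hom
          (Complex.I * (Real.sqrt d : ℂ)) ⊓ hodgeOneZero hsp) = 3 →
    ∃ (V : SchemeOver ℂ) (hV : IsSmoothProjective 3 V) (g : V ⟶ A.X),
      complexGysin complexOrientationFamily hV hsp g
        (rfl : 0 + 2 * (2 * 3) = 2 * 3 + 2 * 3)
        (singularCohomology.one ℂ (ComplexPoints V)) ∉ nonWeil A φ d)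

/-! ## §1 Algebraic classes off the mixed span come from threefolds -/

section Threefold

variable {A : AbelianVariety ℂ}

/-- **Some algebraic class lies off `W'` iff some threefold class `g_* 1_V` does**: `N³H⁶(A(ℂ); ℂ)`
is the span of the classes `g_* 1_V`, `g : V ⟶ A` a smooth projective threefold
(`algebraicClasses_eq_span_complexGysin_one`), and a span lies in the submodule `W'` as soon as its
generators do. [cite: Fulton1998, §19.1 Lemma 19.1.1] [cite: DeligneHodgeIII1974, Cor. 8.2.8] -/
theorem exists_algebraic_not_mem_nonWeil_iff_exists_threefold {d : ℕ} (hX : IsSmoothProjective (2 * 3) A.X)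
    {φ : A ⟶ A} :
    (∃ s ∈ algebraicClasses A.X 3, s ∉ nonWeil A φ d) ↔
      ∃ (V : SchemeOver ℂ) (hV : IsSmoothProjective 3 V) (g : V ⟶ A.X),
        complexGysin complexOrientationFamily hV hX g
          (show 0 + 2 * (2 * 3) = 2 * 3 + 2 * 3 by norm_num)
          (singularCohomology.one ℂ (ComplexPoints V)) ∉ nonWeil A φ d := by
  constructor
  · rintro ⟨s, hs, hsW'⟩
    by_contra! hall
    apply hsW'
    rw [algebraicClasses_eq_span_complexGysin_one complexOrientationFamily 3 3 (by norm_num) hX] at hs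
    refine (Submodule.span_le.mpr ?_) hs
    rintro _ ⟨V, hV, g, rfl⟩
    exact hall V hV g
  · rintro ⟨V, hV, g, hg⟩
    exact ⟨_, complexGysin_one_mem_algebraicClasses_codim complexOrientationFamily
      (show 3 + 3 = 2 * 3 by norm_num) hV hX g _, hg⟩

/-- **On a BALANCED Weil sixfold: the Hodge conjecture for the Weil plane `⟺` ONE smooth projective
threefold `g : V ⟶ A` whose class `g_* 1_V` has a non-zero Weil component** (part 2's
`weilSixfolds_pointwise_iff_exists_algebraic_not_mem_nonWeil` and §1).
[cite: Thomas2005Nodes, §4] [cite: vanGeemen1994HodgeAV, proof of Thm. 6.12] [cite: Deligne1982HodgeCycles, Prop. 4.4] -/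
theorem weilSixfolds_pointwise_iff_exists_threefold {d : ℕ} (hd : 0 < d) (hdim : A.dim = 2 * 3)
    {φ : A ⟶ A} (hφ : φ ≫ φ = -(d • 𝟙 A))
    (hbal : Module.finrank ℂ ↥(Module.End.eigenspace (complexBetti.map φ.hom.hom.hom 1).hom
          (Complex.I * (Real.sqrt d : ℂ)) ⊓ hodgeOneZero (isSmoothProjective_of_dim_eq' hdim)) = 3) :
    (∀ c : singularCohomology ℂ ℂ (ComplexPoints A.X) (2 * 3), IsRationalClass c →
      IsOfHodgeType (2 * 3) A.X (2 * 3) 3 3 c →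
      (∃ c₁ c₂ : singularCohomology ℂ ℂ (ComplexPoints A.X) (2 * 3), c = c₁ + c₂ ∧
        (∀ x y : ℕ, singularCohomology.map ℂ ℂ (AlgPoints.mapContinuous (L := ℂ) (x • 𝟙 A + y • φ).hom.hom.hom) (2 * 3) c₁ =
          ((x : ℂ) + (y : ℂ) * Complex.I * (Real.sqrt d : ℂ)) ^ (2 * 3) • c₁) ∧
        (∀ x y : ℕ, singularCohomology.map ℂ ℂ (AlgPoints.mapContinuous (L := ℂ) (x • 𝟙 A + y • φ).hom.hom.hom) (2 * 3) c₂ =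
          ((x : ℂ) - (y : ℂ) * Complex.I * (Real.sqrt d : ℂ)) ^ (2 * 3) • c₂)) →
      c ∈ algebraicClasses A.X 3) ↔
    ∃ (V : SchemeOver ℂ) (hV : IsSmoothProjective 3 V) (g : V ⟶ A.X),
      complexGysin complexOrientationFamily hV (isSmoothProjective_of_dim_eq' hdim) g
        (show 0 + 2 * (2 * 3) = 2 * 3 + 2 * 3 by norm_num)
        (singularCohomology.one ℂ (ComplexPoints V)) ∉ nonWeil A φ d :=
  (weilSixfolds_pointwise_iff_exists_algebraic_not_mem_nonWeil hd hdim hφ hbal).trans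
    (exists_algebraic_not_mem_nonWeil_iff_exists_threefold _)

end Threefold

/-! ## §2 The route target is EQUIVALENT to the threefold carrier statement -/

section Target

/-- **`ThreefoldWeilCarriers → WeilSixfolds`** (stmt-2524 BY NAME): a non-zero rational `(3,3)` Weil
class forces balancedness (Deligne–Milne 4.4), the carrier statement supplies a threefold off `W'`,
and §1 + part 2 conclude. [cite: Thomas2005Nodes, §4] [cite: Deligne1982HodgeCycles, Prop. 4.4] -/
theorem weilSixfolds_of_threefoldWeilCarriers (hT : ThreefoldWeilCarriers) :
    Summit.HodgeConjecture.HodgeConjecture.Theses.NodalThetaWeil.WeilSixfolds := by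
  intro d hd A φ hdim hsp hφ c hr hh hw
  have hcW : c ∈ weilClassesOf A φ 3 d := mem_weilClassesOf_iff.mpr hw
  by_cases hc : c = 0
  · rw [hc]
    exact Submodule.zero_mem _
  have hbal := finrank_eq_of_mem_weilClassesOf (m := 3) (by norm_num) hdim hd hφ hcW hc hh
  obtain ⟨V, hV, g, hg⟩ := hT d hd A φ hdim hsp hφ hbal
  exact weilSixfolds_pointwise_of_algebraic_not_mem_nonWeil hd hdim hφ
    ((exists_algebraic_not_mem_nonWeil_iff_exists_threefold hsp).mpr ⟨V, hV, g, hg⟩) c hr hh hw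

/-- **`WeilSixfolds → ThreefoldWeilCarriers`**: on a balanced Weil sixfold the Weil plane contains a
non-zero RATIONAL class of type `(3,3)`, algebraic by `WeilSixfolds`, off `W'` by `W ∩ W' = 0`; write
it over threefold classes (§1). [cite: vanGeemen1994HodgeAV, 4.9–4.10] [cite: Fulton1998, §19.1] -/
theorem threefoldWeilCarriers_of_weilSixfolds
    (hW : Summit.HodgeConjecture.HodgeConjecture.Theses.NodalThetaWeil.WeilSixfolds) :
    ThreefoldWeilCarriers := by
  intro d hd A φ hdim hsp hφ hbal
  exact (weilSixfolds_pointwise_iff_exists_threefold hd hdim hφ hbal).mp (hW d hd A φ hdim hsp hφ)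

/-- **THE ROUTE TARGET `WeilSixfolds` (stmt-HodgeConjecture-2524) IS EQUIVALENT TO THE THREEFOLD
CARRIER STATEMENT**: Weil classes on abelian sixfolds are algebraic iff every balanced Weil sixfold
`(A, φ ≫ φ = -d·𝟙)` carries a smooth projective threefold `g : V ⟶ A` whose fundamental class
`g_* 1_V ∈ H⁶(A(ℂ); ℂ)` is not in the span of the mixed `K`-eigenclass spaces — an honest equivalence
split locating all the difficulty in ONE explicit cycle with a period-free certificate per sixfold.
[cite: Thomas2005Nodes, §4] [cite: vanGeemen1994HodgeAV, 4.9–4.11 and proof of Thm. 6.12]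
[cite: Deligne1982HodgeCycles, Prop. 4.4] [cite: Fulton1998, §19.1] -/
theorem weilSixfolds_iff_threefoldWeilCarriers :
    Summit.HodgeConjecture.HodgeConjecture.Theses.NodalThetaWeil.WeilSixfolds ↔ ThreefoldWeilCarriers :=
  ⟨threefoldWeilCarriers_of_weilSixfolds, weilSixfolds_of_threefoldWeilCarriers⟩

/-- **The crux `NodeDualClassesAlgebraic` (stmt-HodgeConjecture-7745) BY NAME from the threefold
carrier statement** (the crux is the supported case of the target). [cite: Thomas2005Nodes, Thm. 1 and §4] -/
theorem nodeDualClassesAlgebraic_of_threefoldWeilCarriers (hT : ThreefoldWeilCarriers) :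
    Summit.HodgeConjecture.HodgeConjecture.Theses.NodalThetaWeil.NodeDualClassesAlgebraic :=
  fun d hd A φ hdim hsp hφ c hr hh hw _ ↦
    weilSixfolds_of_threefoldWeilCarriers hT d hd A φ hdim hsp hφ c hr hh hw

/-- **The sibling crux `NodalThetaSupport` (stmt-HodgeConjecture-7744) BY NAME from the same
statement**: algebraic classes are supported in codimension `3 ≥ 1` (`supportedClasses_mono`). So ONE
carrier statement closes both cruxes X1, X2 of the route. [cite: Thomas2005Nodes, Thm. 1] [cite: GrothendieckTopology1969, §1] -/
theorem nodalThetaSupport_of_threefoldWeilCarriers (hT : ThreefoldWeilCarriers) :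
    Summit.HodgeConjecture.HodgeConjecture.Theses.NodalThetaWeil.NodalThetaSupport :=
  fun d hd A φ hdim hsp hφ c hr hh hw ↦
    supportedClasses_mono A.X (2 * 3) (show 1 ≤ 3 by norm_num)
      (weilSixfolds_of_threefoldWeilCarriers hT d hd A φ hdim hsp hφ c hr hh hw)

/-- **The nodal-boundary carrier statement (part 2) implies the threefold carrier statement** by
forgetting `Θ`, `k`, the nodal member and the node: compose `h : V ⟶ D` with `ι : D ↪ A`. (Conversely
every threefold of `A⁶` sits in a nodal high multiple of `Θ` singular exactly at finitely many of its
points with maximal-isotropic tangent spaces — Kleiman–Altman's Bertini theorem, not typed here — so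
GIVEN the cycle the nodal decoration is free.) [cite: Thomas2005Nodes, Thm. 1 and §3 eq. (d)] -/
theorem threefoldWeilCarriers_of_nodalThetaCarriers
    (hB : ∀ (d : ℕ), 0 < d → ∀ (A : AbelianVariety ℂ) (φ : A ⟶ A), A.dim = 2 * 3 →
      ∀ hsp : IsSmoothProjective (2 * 3) A.X, φ ≫ φ = -(d • 𝟙 A) →
      Module.finrank ℂ ↥(Module.End.eigenspace (complexBetti.map φ.hom.hom.hom 1).hom
            (Complex.I * (Real.sqrt d : ℂ)) ⊓ hodgeOneZero hsp) = 3 →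
      ∃ (Θ : CartierDivisor A.X.left) (k : ℕ) (D : SchemeOver ℂ) (ι : D ⟶ A.X),
        Θ.IsAmple ∧ 2 ≤ k ∧ IsNodalThetaMember A Θ k ι ∧
        ∃ (V : SchemeOver ℂ) (hV : IsSmoothProjective 3 V) (h : V ⟶ D),
          (∃ v : V.left, ¬ IsRegularLocalRing (D.left.presheaf.stalk (h.left.base v))) ∧
          complexGysin complexOrientationFamily hV hsp (h ≫ ι)
            (show 0 + 2 * (2 * 3) = 2 * 3 + 2 * 3 by norm_num)
            (singularCohomology.one ℂ (ComplexPoints V)) ∉ nonWeil A φ d) :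
    ThreefoldWeilCarriers := by
  intro d hd A φ hdim hsp hφ hbal
  obtain ⟨Θ, k, D, ι, -, -, -, V, hV, h, -, hvis⟩ := hB d hd A φ hdim hsp hφ hbal
  exact ⟨V, hV, h ≫ ι, hvis⟩

end Target

end Summit.HodgeConjecture.HodgeConjecture.Theorems.NodeDualClassesAlgebraic

end
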